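import Mathlib.Analysis.SpecialFunctions.Sqrt
import Mathlib.Topology.Algebra.Order.Field
import HarnessLib

/-!
# Buckmaster–Cao-Labora–Gómez-Serrano at `γ = 5/3`: the phase-portrait algebra in closed form

Topic `Literature/Analysis/FluidPDE`; namespace
`Literature.Analysis.FluidPDE.BuckmasterCaolaboraGomezserrano2025.Monatomic`. Companion of
`CompressibleEulerImplosion.lean` (named fact `BuckmasterCaolaboraGomezserrano2025_thm11_monatomic`,
THEOREM 1.1 of T. Buckmaster, G. Cao-Labora, J. Gómez-Serrano, *Smooth imploding solutions for 3D
compressible fluids*, Forum Math. Pi 13 (2025) e6, arXiv:2208.09445, at `γ = 5/3`) and of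
`CompressibleEulerImplosionProofs.lean` (the glue layer). Brick B of the discharge plan: §2.1
("First order expansion"), Lemma 2.1, eq. (3.2) and Lemma 9.17 (equilibria), and the enclosures
of `r₃(γ), r₄(γ)` of Appendix Lemmas 10.1–10.2, all SPECIALISED to the monatomic exponent
`γ = 5/3` (`α = (γ−1)/2 = 1/3`), where — this is the point of the file — every quantity of §2.1 is
available in CLOSED FORM and the two computer-assisted steps of this part of the paper (the proof
of `k′(r) > 0` in Lemma 2.1, and the polynomial enclosures of `r₃, r₄`) are replaced by exact
algebra:

* the autonomous system (1.8) at `α = 1/3`: `D_W = 1 + (2W+Z)/3`, `D_Z = 1 + (W+2Z)/3`,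
  `N_W = −(r + 5W/6 + Z/3)W + Z²/6`, `N_Z = −(r + W/3 + 5Z/6)Z + W²/6` (`DW`, `DZ`, `NW`, `NZ`);
* (2.2): `ℛ₁ = (4/3)·q`, `q(r) = √(r² − 6r + 6)`; (2.1): `P_s = (3 − 2r + 2q, r − 3 − q)`,
  `P̄_s = (3 − 2r − 2q, r − 3 + q)`, the only two solutions of `D_Z = N_Z = 0`
  (`DZ_NZ_eq_zero_iff`); `D_W(P_s) = 2 − r + q > 0`, `N_W(P_s) = −3q(2 − r + q)`, so (2.2)
  `W₁ = N_W(P_s)/D_W(P_s) = −3q`;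
* (2.5): `ℛ₂ = 4·p`, `p(r) = √(2(r−1))`; (2.3)–(2.4): the two slopes at `P_s` are
  `Z₁ = (3/2)(2 − r + q − p)` (direction `ν₋`, the smooth imploding profile) and
  `Ž₁ = (3/2)(2 − r + q + p)` (direction `ν₊`, Guderley), the two roots of the quadratic (2.3);
* `D_{Z,1} = ∇D_Z(P_s)·(W₁,Z₁) = 2 − r − p`, `Ď_{Z,1} = 2 − r + p`, and (2.9)
  `k(r) = Ď_{Z,1}/D_{Z,1} = (2 − r + p)/(2 − r − p)`;
* Lemma 2.1 at `γ = 5/3`: `k(1) = 1`, `k` strictly increasing on `[1, r*)`, `k → +∞` at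
  `r* = r*(5/3) = 3 − √3` (where `D_{Z,1} = 0`, Lemma "aux_DZ1_cancellation", and where `q = 0`,
  i.e. `P_s = P̄_s`); `D_{Z,1} > 0` on `[1, r*)` (Lemma "aux_DZ1");
* `r₃(5/3) = 6 − 2√6 = 1.1010205…` and `r₄(5/3) = (43 − 5√43)/9 = 1.1347563…`, i.e.
  `k(r₃) = 3`, `k(r₄) = 4` (the paper's definition `k(r_j) = j`, §1.4), with the window
  `1.10102 < r₃ < r₄ < 1.13476` used by the vendored fact (the paper's certified enclosures,
  Lemmas 10.1–10.2 at `γ_inv = 3/5`, give `1.1010205 ± 1.5·10⁻⁸`, `1.1347564 ± 1.5·10⁻⁸`);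
* Lemma 9.17 / eq. (3.2): the equilibria `N_W = N_Z = 0` are `(0,0) = P_∞`, `(−r,−r)`,
  `P_eye = ((√3−1)r/2, −(1+√3)r/2)` and its mirror image across the diagonal.

Everything here is PROVED (definitions with bodies + theorems; no facts).
[cite: BuckmasterCaolaboraGomezserrano2025, §1.3 (1.8), §1.4, §2.1 (2.1)–(2.9), Lemma 2.1, (3.2), Lemma 9.17, App. Lemmas 10.1–10.2]
-/

noncomputable section

open Set Filter Topology

namespace Literature.Analysis.FluidPDE

namespace BuckmasterCaolaboraGomezserrano2025

namespace Monatomic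

/-! ### The autonomous system (1.8) at `α = 1/3` -/

/-- `D_W(W,Z) = 1 + ½(W + Z + α(W − Z))` at `α = 1/3`.
[cite: BuckmasterCaolaboraGomezserrano2025, §1.3 eq. (1.8)] -/
def DW (W Z : ℝ) : ℝ := 1 + (2 * W + Z) / 3

/-- `D_Z(W,Z) = 1 + ½(W + Z − α(W − Z))` at `α = 1/3`.
[cite: BuckmasterCaolaboraGomezserrano2025, §1.3 eq. (1.8)] -/
def DZ (W Z : ℝ) : ℝ := 1 + (W + 2 * Z) / 3

/-- `N_W(W,Z) = −(r + ½((1+2α)W + (1−α)Z))W + (α/2)Z²` at `α = 1/3`.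
[cite: BuckmasterCaolaboraGomezserrano2025, §1.3 eq. (1.8)] -/
def NW (r W Z : ℝ) : ℝ := -(r + 5 * W / 6 + Z / 3) * W + Z ^ 2 / 6

/-- `N_Z(W,Z) = −(r + ½((1−α)W + (1+2α)Z))Z + (α/2)W²` at `α = 1/3`.
[cite: BuckmasterCaolaboraGomezserrano2025, §1.3 eq. (1.8)] -/
def NZ (r W Z : ℝ) : ℝ := -(r + W / 3 + 5 * Z / 6) * Z + W ^ 2 / 6

/-- `D_W − D_Z = α(W − Z)`: positivity of the density `W − Z > 0` is `D_W > D_Z`. [folklore] -/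
theorem DW_sub_DZ (W Z : ℝ) : DW W Z - DZ W Z = (W - Z) / 3 := by
  unfold DW DZ; ring

/-- `D_W`, `D_Z` are affine: exact first-order expansion (eq. (2.10): `D_{∘,n} = ∇D_∘·(W_n,Z_n)`).
[cite: BuckmasterCaolaboraGomezserrano2025, eq. (2.10)] -/
theorem DW_expand (W Z a b : ℝ) : DW (W + a) (Z + b) = DW W Z + (2 / 3 * a + 1 / 3 * b) := by
  unfold DW; ring

/-- [cite: BuckmasterCaolaboraGomezserrano2025, eq. (2.10)] -/
theorem DZ_expand (W Z a b : ℝ) : DZ (W + a) (Z + b) = DZ W Z + (1 / 3 * a + 2 / 3 * b) := by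
  unfold DZ; ring

/-- `∂_W N_W`. [cite: BuckmasterCaolaboraGomezserrano2025, eq. (2.11)] -/
def NW_W (r W Z : ℝ) : ℝ := -(r + 5 * W / 3 + Z / 3)

/-- `∂_Z N_W`. [cite: BuckmasterCaolaboraGomezserrano2025, eq. (2.11)] -/
def NW_Z (W Z : ℝ) : ℝ := (Z - W) / 3

/-- `∂_W N_Z`. [cite: BuckmasterCaolaboraGomezserrano2025, eq. (2.11)] -/
def NZ_W (W Z : ℝ) : ℝ := (W - Z) / 3

/-- `∂_Z N_Z`. [cite: BuckmasterCaolaboraGomezserrano2025, eq. (2.11)] -/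
def NZ_Z (r W Z : ℝ) : ℝ := -(r + W / 3 + 5 * Z / 3)

/-- `N_W` is quadratic with constant Hessian: exact second-order expansion (eq. (2.11)).
[cite: BuckmasterCaolaboraGomezserrano2025, eq. (2.11)] -/
theorem NW_expand (r W Z a b : ℝ) :
    NW r (W + a) (Z + b) =
      NW r W Z + (NW_W r W Z * a + NW_Z W Z * b) + (-(5 / 6) * a ^ 2 - a * b / 3 + b ^ 2 / 6) := by
  unfold NW NW_W NW_Z; ring

/-- `N_Z` is quadratic with constant Hessian: exact second-order expansion (eq. (2.11)).
[cite: BuckmasterCaolaboraGomezserrano2025, eq. (2.11)] -/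
theorem NZ_expand (r W Z a b : ℝ) :
    NZ r (W + a) (Z + b) =
      NZ r W Z + (NZ_W W Z * a + NZ_Z r W Z * b) + (a ^ 2 / 6 - a * b / 3 - 5 / 6 * b ^ 2) := by
  unfold NZ NZ_W NZ_Z; ring

/-! ### Equilibria (eq. (3.2), Lemma 9.17) -/

/-- `N_W − N_Z = −(W − Z)(r + W + Z)`: an equilibrium lies on the diagonal or on `W + Z = −r`.
[cite: BuckmasterCaolaboraGomezserrano2025, Lemma 9.17] -/
theorem NW_sub_NZ (r W Z : ℝ) : NW r W Z - NZ r W Z = -(W - Z) * (r + W + Z) := by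
  unfold NW NZ; ring

/-- On the diagonal the field is diagonal: `N_W(W,W) = N_Z(W,W) = −W(r + W)` (the diagonal
`W = Z` is invariant). [cite: BuckmasterCaolaboraGomezserrano2025, proof of Prop. 3.1] -/
theorem NW_diag (r W : ℝ) : NW r W W = -W * (r + W) ∧ NZ r W W = -W * (r + W) := by
  unfold NW NZ; constructor <;> ring

/-- `X₀ = 2(√3−1)r/(3γ−1) = (√3−1)r/2` at `γ = 5/3`.
[cite: BuckmasterCaolaboraGomezserrano2025, eq. (3.2)] -/
def Xeye (r : ℝ) : ℝ := (√3 - 1) * r / 2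

/-- `Y₀ = −2(1+√3)r/(3γ−1) = −(1+√3)r/2` at `γ = 5/3`.
[cite: BuckmasterCaolaboraGomezserrano2025, eq. (3.2)] -/
def Yeye (r : ℝ) : ℝ := -(1 + √3) * r / 2

/-- [folklore] -/
private theorem sqrt3_sq : (√3 : ℝ) ^ 2 = 3 := Real.sq_sqrt (by norm_num)

/-- `P_eye` is an equilibrium. [cite: BuckmasterCaolaboraGomezserrano2025, eq. (3.2)] -/
theorem NW_eye (r : ℝ) : NW r (Xeye r) (Yeye r) = 0 := by
  unfold NW Xeye Yeye
  linear_combination (-(r ^ 2 / 12) : ℝ) * sqrt3_sq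

/-- `P_eye` is an equilibrium. [cite: BuckmasterCaolaboraGomezserrano2025, eq. (3.2)] -/
theorem NZ_eye (r : ℝ) : NZ r (Xeye r) (Yeye r) = 0 := by
  unfold NZ Xeye Yeye
  linear_combination (-(r ^ 2 / 12) : ℝ) * sqrt3_sq

/-- **Lemma 9.17 (γ = 5/3), classification of equilibria.** The solutions of `N_W = N_Z = 0` are
`P_∞ = (0,0)`, `(−r,−r)`, `P_eye` and its mirror image in the diagonal (which lies in `Z > W`).
[cite: BuckmasterCaolaboraGomezserrano2025, Lemma 9.17] -/
theorem equilibria {r W Z : ℝ} (hW : NW r W Z = 0) (hZ : NZ r W Z = 0) :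
    (W = 0 ∧ Z = 0) ∨ (W = -r ∧ Z = -r) ∨ (W = Xeye r ∧ Z = Yeye r) ∨ (W = Yeye r ∧ Z = Xeye r) := by
  have hdiff : -(W - Z) * (r + W + Z) = 0 := by rw [← NW_sub_NZ, hW, hZ, sub_zero]
  rcases mul_eq_zero.mp hdiff with h | h
  · -- on the diagonal
    have hWZ : Z = W := by linarith
    subst hWZ
    have h1 : -Z * (r + Z) = 0 := by rw [← (NW_diag r Z).1, hW]
    rcases mul_eq_zero.mp h1 with h2 | h2
    · left; constructor <;> linarith
    · right; left; constructor <;> linarith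
  · -- on the anti-diagonal `W + Z = −r`
    have hZ' : Z = -r - W := by linarith
    subst hZ'
    have h1 : (2 * W + r) ^ 2 = (√3 * r) ^ 2 := by
      unfold NW at hW
      linear_combination (-12 : ℝ) * hW - r ^ 2 * sqrt3_sq
    rcases sq_eq_sq_iff_eq_or_eq_neg.mp h1 with h2 | h2
    · right; right; left
      unfold Xeye Yeye
      constructor <;> linarith
    · right; right; right
      unfold Xeye Yeye
      constructor <;> linarith

/-! ### The sonic point `P_s` (§2.1) -/

/-- `(9/16)ℛ₁² = r² − 6r + 6` at `γ = 5/3` (eq. (2.2): `ℛ₁² = γ²(r−3)² − 2γ(3r²−6r+7) + 9r²−14r+9`).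
[cite: BuckmasterCaolaboraGomezserrano2025, eq. (2.2)] -/
def disc (r : ℝ) : ℝ := r ^ 2 - 6 * r + 6

/-- `q = (3/4)ℛ₁ = √(r² − 6r + 6)`. [cite: BuckmasterCaolaboraGomezserrano2025, eq. (2.2)] -/
def q (r : ℝ) : ℝ := √(disc r)

/-- `p = ℛ₂/4 = √(2(r−1))` at `γ = 5/3` (eq. (2.5), where the factor `1/(γ−1)` multiplies the
square root and the coefficient of `ℛ₁` inside vanishes at `γ = 5/3`).
[cite: BuckmasterCaolaboraGomezserrano2025, eq. (2.5)] -/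
def p (r : ℝ) : ℝ := √(2 * (r - 1))

/-- `r*(γ) = (3γ−1)/(2+√3(γ−1)) = 3 − √3` at `γ = 5/3`.
[cite: BuckmasterCaolaboraGomezserrano2025, eq. (1.12)] -/
def rstar : ℝ := 3 - √3

/-- The general formula (2.2) for `ℛ₁²` at `γ = 5/3` is `(16/9)(r² − 6r + 6)`. [cite: BuckmasterCaolaboraGomezserrano2025, eq. (2.2)] -/
theorem R1_sq_general (r : ℝ) :
    (5 / 3 : ℝ) ^ 2 * (r - 3) ^ 2 - 2 * (5 / 3) * (3 * r ^ 2 - 6 * r + 7) + (9 * r ^ 2 - 14 * r + 9)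
      = 16 / 9 * disc r := by
  unfold disc; ring

/-- The general formula (1.12) for `r*` at `γ = 5/3` is `3 − √3`. [cite: BuckmasterCaolaboraGomezserrano2025, eq. (1.12)] -/
theorem rstar_general : (3 * (5 / 3 : ℝ) - 1) / (2 + √3 * (5 / 3 - 1)) = rstar := by
  unfold rstar
  have h3 := sqrt3_sq
  have hpos : (0 : ℝ) < 2 + √3 * (5 / 3 - 1) := by positivity
  rw [div_eq_iff hpos.ne']
  linear_combination (2 / 3 : ℝ) * h3

/-- [folklore] -/
theorem disc_eq (r : ℝ) : disc r = (3 - r) ^ 2 - 3 := by unfold disc; ring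

/-- [folklore] -/
theorem one_lt_rstar : 1 < rstar := by
  unfold rstar
  have : √3 < 2 := (Real.sqrt_lt' (by norm_num)).mpr (by norm_num)
  linarith

/-- [folklore] -/
theorem rstar_lt : rstar < 1.268 := by
  unfold rstar
  have : (1.732 : ℝ) < √3 := (Real.lt_sqrt (by norm_num)).mpr (by norm_num)
  linarith

/-- `ℛ₁² > 0` for `r < r*`. [cite: BuckmasterCaolaboraGomezserrano2025, §2.1] -/
theorem disc_pos {r : ℝ} (h : r < rstar) : 0 < disc r := by
  unfold rstar at h
  have h1 : √3 < 3 - r := by linarith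
  have h2 : (3 : ℝ) < (3 - r) ^ 2 := by
    calc (3 : ℝ) = √3 ^ 2 := sqrt3_sq.symm
      _ < (3 - r) ^ 2 := pow_lt_pow_left₀ h1 (Real.sqrt_nonneg 3) two_ne_zero
  rw [disc_eq]; linarith

/-- `ℛ₁ = 0` at `r = r*`: `P_s` and `P̄_s` merge. [cite: BuckmasterCaolaboraGomezserrano2025, §2.1] -/
theorem disc_rstar : disc rstar = 0 := by
  rw [disc_eq]; unfold rstar
  linear_combination sqrt3_sq

/-- [folklore] -/
theorem q_nonneg (r : ℝ) : 0 ≤ q r := Real.sqrt_nonneg _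

/-- [folklore] -/
theorem q_sq {r : ℝ} (h : 0 ≤ disc r) : q r ^ 2 = r ^ 2 - 6 * r + 6 := Real.sq_sqrt h

/-- `ℛ₁ > 0` for `r < r*`. [cite: BuckmasterCaolaboraGomezserrano2025, §2.1] -/
theorem q_pos {r : ℝ} (h : r < rstar) : 0 < q r := Real.sqrt_pos.mpr (disc_pos h)

/-- [folklore] -/
theorem q_rstar : q rstar = 0 := by unfold q; rw [disc_rstar, Real.sqrt_zero]

/-- [folklore] -/
theorem p_nonneg (r : ℝ) : 0 ≤ p r := Real.sqrt_nonneg _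

/-- [folklore] -/
theorem p_sq {r : ℝ} (h : 1 ≤ r) : p r ^ 2 = 2 * (r - 1) := Real.sq_sqrt (by linarith)

/-- [folklore] -/
theorem p_pos {r : ℝ} (h : 1 < r) : 0 < p r := Real.sqrt_pos.mpr (by linarith)

/-- `ℛ₂ = 0` at `r = 1` (so `k(1) = 1`). [cite: BuckmasterCaolaboraGomezserrano2025, Lemma 2.1] -/
theorem p_one : p 1 = 0 := by simp [p]

/-- `p(r*) = √3 − 1 = 2 − r*`. [cite: BuckmasterCaolaboraGomezserrano2025, Lemma 2.1] -/
theorem p_rstar : p rstar = √3 - 1 := by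
  unfold p rstar
  have h0 : (0 : ℝ) ≤ √3 - 1 := by linarith [one_lt_rstar, show rstar = 3 - √3 from rfl,
    (Real.lt_sqrt (by norm_num : (0:ℝ) ≤ 1)).mpr (by norm_num : (1:ℝ) ^ 2 < 3)]
  rw [show (2 : ℝ) * (3 - √3 - 1) = (√3 - 1) ^ 2 by linear_combination (-1 : ℝ) * sqrt3_sq]
  exact Real.sqrt_sq h0

/-- `W₀ = 3 − 2r + 2q` ((2.1) at `γ = 5/3`). [cite: BuckmasterCaolaboraGomezserrano2025, eq. (2.1)] -/
def W0 (r : ℝ) : ℝ := 3 - 2 * r + 2 * q r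

/-- `Z₀ = r − 3 − q` ((2.1) at `γ = 5/3`). [cite: BuckmasterCaolaboraGomezserrano2025, eq. (2.1)] -/
def Z0 (r : ℝ) : ℝ := r - 3 - q r

/-- `W̄₀ = 3 − 2r − 2q`. [cite: BuckmasterCaolaboraGomezserrano2025, eq. (2.1)] -/
def W0bar (r : ℝ) : ℝ := 3 - 2 * r - 2 * q r

/-- `Z̄₀ = r − 3 + q`. [cite: BuckmasterCaolaboraGomezserrano2025, eq. (2.1)] -/
def Z0bar (r : ℝ) : ℝ := r - 3 + q r

/-- The general formulas (2.1) for `P_s` at `γ = 5/3` (with `ℛ₁ = (4/3)q`). [cite: BuckmasterCaolaboraGomezserrano2025, eq. (2.1)] -/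
theorem Ps_general (r : ℝ) :
    ((5 / 3 : ℝ) ^ 2 * r + (5 / 3 + 1) * (4 / 3 * q r) - 3 * (5 / 3) ^ 2 - 2 * (5 / 3) * r
        + 10 * (5 / 3) - 3 * r - 3) / (4 * (5 / 3 - 1) ^ 2) = W0 r ∧
    ((5 / 3 : ℝ) ^ 2 * r + (5 / 3 - 3) * (4 / 3 * q r) - 3 * (5 / 3) ^ 2 - 6 * (5 / 3) * r
        + 6 * (5 / 3) + 9 * r - 7) / (4 * (5 / 3 - 1) ^ 2) = Z0 r := by
  unfold W0 Z0; constructor <;> ring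

/-- `P_s` lies on the sonic line `D_Z = 0`. [cite: BuckmasterCaolaboraGomezserrano2025, §2.1] -/
theorem DZ_Ps (r : ℝ) : DZ (W0 r) (Z0 r) = 0 := by unfold DZ W0 Z0; ring

/-- `P̄_s` lies on the sonic line `D_Z = 0`. [cite: BuckmasterCaolaboraGomezserrano2025, §2.1] -/
theorem DZ_Psbar (r : ℝ) : DZ (W0bar r) (Z0bar r) = 0 := by unfold DZ W0bar Z0bar; ring

/-- `N_Z(P_s) = 0`. [cite: BuckmasterCaolaboraGomezserrano2025, §2.1] -/
theorem NZ_Ps {r : ℝ} (h : 0 ≤ disc r) : NZ r (W0 r) (Z0 r) = 0 := by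
  have hq := q_sq h
  unfold NZ W0 Z0
  linear_combination (1 / 2 : ℝ) * hq

/-- `N_Z(P̄_s) = 0`. [cite: BuckmasterCaolaboraGomezserrano2025, §2.1] -/
theorem NZ_Psbar {r : ℝ} (h : 0 ≤ disc r) : NZ r (W0bar r) (Z0bar r) = 0 := by
  have hq := q_sq h
  unfold NZ W0bar Z0bar
  linear_combination (1 / 2 : ℝ) * hq

/-- "The points `P_s` and `P̄_s` are the only intersections of `D_Z = N_Z = 0`."
[cite: BuckmasterCaolaboraGomezserrano2025, §2.1] -/
theorem DZ_NZ_eq_zero_iff {r W Z : ℝ} (h : 0 ≤ disc r) :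
    (DZ W Z = 0 ∧ NZ r W Z = 0) ↔ (W = W0 r ∧ Z = Z0 r) ∨ (W = W0bar r ∧ Z = Z0bar r) := by
  constructor
  · rintro ⟨hD, hN⟩
    have hW : W = -3 - 2 * Z := by unfold DZ at hD; linarith
    subst hW
    have hq := q_sq h
    have h1 : (Z + 3 - r) ^ 2 = q r ^ 2 := by
      unfold NZ at hN
      linear_combination (2 : ℝ) * hN - hq
    rcases sq_eq_sq_iff_eq_or_eq_neg.mp h1 with h2 | h2
    · right
      unfold W0bar Z0bar
      constructor <;> linarith
    · left
      unfold W0 Z0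
      constructor <;> linarith
  · rintro (⟨rfl, rfl⟩ | ⟨rfl, rfl⟩)
    · exact ⟨DZ_Ps r, NZ_Ps h⟩
    · exact ⟨DZ_Psbar r, NZ_Psbar h⟩

/-- `D_W(P_s) = 2 − r + q` (so `D_{W,0} > 0`, Lemma "aux_DW0"). [cite: BuckmasterCaolaboraGomezserrano2025, §2.1] -/
theorem DW_Ps (r : ℝ) : DW (W0 r) (Z0 r) = 2 - r + q r := by unfold DW W0 Z0; ring

/-- Lemma "aux_DW0" at `γ = 5/3`: `D_W(P_s) > 0` for `r < 2`. [cite: BuckmasterCaolaboraGomezserrano2025, Prop. 2.2] -/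
theorem DW_Ps_pos {r : ℝ} (h : r < 2) : 0 < DW (W0 r) (Z0 r) := by
  rw [DW_Ps]; linarith [q_nonneg r]

/-- `N_W(P_s) = −3q(2 − r + q)` (`< 0` for `1 < r < r*`). [cite: BuckmasterCaolaboraGomezserrano2025, §2.1] -/
theorem NW_Ps {r : ℝ} (h : 0 ≤ disc r) : NW r (W0 r) (Z0 r) = -3 * q r * (2 - r + q r) := by
  have hq := q_sq h
  unfold NW W0 Z0
  linear_combination (1 / 2 : ℝ) * hq

/-- `N_{W,0} = N_W(P_s) < 0` for `r < r*`. [cite: BuckmasterCaolaboraGomezserrano2025, §4 (sign of `C₃`)] -/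
theorem NW_Ps_neg {r : ℝ} (h : r < rstar) : NW r (W0 r) (Z0 r) < 0 := by
  rw [NW_Ps (disc_pos h).le]
  have hq := q_pos h
  have : r < 2 := by linarith [rstar_lt]
  nlinarith

/-- `∂_W N_Z(P_s) = (W₀ − Z₀)/3 = 2 − r + q = D_W(P_s)`. [cite: BuckmasterCaolaboraGomezserrano2025, §2.1] -/
theorem NZ_W_Ps (r : ℝ) : NZ_W (W0 r) (Z0 r) = 2 - r + q r := by unfold NZ_W W0 Z0; ring

/-- `∂_Z N_Z(P_s) = 4 − 2r + q`. [cite: BuckmasterCaolaboraGomezserrano2025, §2.1] -/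
theorem NZ_Z_Ps (r : ℝ) : NZ_Z r (W0 r) (Z0 r) = 4 - 2 * r + q r := by unfold NZ_Z W0 Z0; ring

/-! ### The two smooth directions at `P_s` (eqs. (2.2)–(2.5)) -/

/-- `W₁ = −3q` ((2.4) at `γ = 5/3`). [cite: BuckmasterCaolaboraGomezserrano2025, eq. (2.4)] -/
def W1 (r : ℝ) : ℝ := -3 * q r

/-- `Z₁ = (3/2)(2 − r + q − p)` ((2.4) at `γ = 5/3`; direction `ν₋`).
[cite: BuckmasterCaolaboraGomezserrano2025, eq. (2.4)] -/
def Z1 (r : ℝ) : ℝ := 3 / 2 * (2 - r + q r - p r)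

/-- `Ž₁ = (3/2)(2 − r + q + p)` (direction `ν₊`, Guderley). [cite: BuckmasterCaolaboraGomezserrano2025, §2.1] -/
def Z1check (r : ℝ) : ℝ := 3 / 2 * (2 - r + q r + p r)

/-- The general formulas (2.4) for `W₁`, `Z₁` and for `Ž₁` at `γ = 5/3` (`ℛ₁ = (4/3)q`, `ℛ₂ = 4p`).
[cite: BuckmasterCaolaboraGomezserrano2025, eq. (2.4)] -/
theorem slopes_general (r : ℝ) :
    ((5 / 3 : ℝ) * (-3 * (4 / 3 * q r + 6) - 3 * (5 / 3) * (r - 3) + 2 * r) + 4 / 3 * q r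
        + 5 * r + 5) / (4 * (5 / 3 - 1) ^ 2) = W1 r ∧
    (-(3 * (5 / 3 : ℝ) ^ 3 - 7 * (5 / 3) ^ 2 + 5 / 3 + 11) * r
        + 5 / 3 * (5 / 3 * (9 * (5 / 3) - 3 * (4 / 3 * q r) - 25) + 10 * (4 / 3 * q r)
          - 4 * (5 / 3 - 1) * (4 * p r) + 27)
        - 3 * (4 / 3 * q r) + 4 * (5 / 3 - 1) * (4 * p r) - 3) / (4 * (5 / 3 - 1) ^ 2 * (5 / 3 + 1))
      = Z1 r ∧
    -((3 * (5 / 3 : ℝ) ^ 3 - 7 * (5 / 3) ^ 2 + 5 / 3 + 11) * r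
        - 5 / 3 * (5 / 3 * (9 * (5 / 3) - 3 * (4 / 3 * q r) - 25) + 10 * (4 / 3 * q r)
          + 4 * (5 / 3 - 1) * (4 * p r) + 27)
        + 3 * (4 / 3 * q r) + 4 * (5 / 3 - 1) * (4 * p r) + 3) / (4 * (5 / 3 - 1) ^ 2 * (5 / 3 + 1))
      = Z1check r := by
  unfold W1 Z1 Z1check
  refine ⟨by ring, by ring, by ring⟩

/-- The general formula (2.5) for `ℛ₂` at `γ = 5/3` is `4p`: `ℛ₂² = 16 p² = 32(r−1)`.
[cite: BuckmasterCaolaboraGomezserrano2025, eq. (2.5)] -/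
theorem R2_sq_general {r : ℝ} (hr : 1 ≤ r) :
    (1 / (5 / 3 - 1 : ℝ)) ^ 2 *
      (5 / 3 * ((76 - 27 * (5 / 3)) * (5 / 3) - 71) - (3 * (5 / 3) - 5) * ((5 / 3 - 5) * (5 / 3) + 2) * r ^ 2
        + (5 / 3 * (5 / 3 * (18 * (5 / 3) - 52) + 50) - 8) * r
        + 4 / 3 * q r * (9 * (5 / 3 - 2) * (5 / 3) + ((2 - 3 * (5 / 3)) * (5 / 3) + 5) * r + 5) + 18)
      = (4 * p r) ^ 2 := by
  rw [mul_pow, p_sq hr]; ring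

/-- (2.2): `W₁ = N_W(P_s)/D_W(P_s)`. [cite: BuckmasterCaolaboraGomezserrano2025, eq. (2.2)] -/
theorem W1_eq {r : ℝ} (h : r < rstar) : W1 r = NW r (W0 r) (Z0 r) / DW (W0 r) (Z0 r) := by
  have hD := DW_Ps_pos (show r < 2 by linarith [rstar_lt])
  rw [eq_div_iff hD.ne', NW_Ps (disc_pos h).le, DW_Ps, W1]

/-- (2.3) for `Z₁`: `∇D_Z(P_s)·(W₁,Z₁) Z₁ = ∇N_Z(P_s)·(W₁,Z₁)`.
[cite: BuckmasterCaolaboraGomezserrano2025, eq. (2.3)] -/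
theorem slope_eq_Z1 {r : ℝ} (h1 : 1 ≤ r) (h : 0 ≤ disc r) :
    (1 / 3 * W1 r + 2 / 3 * Z1 r) * Z1 r = NZ_W (W0 r) (Z0 r) * W1 r + NZ_Z r (W0 r) (Z0 r) * Z1 r := by
  have hq := q_sq h
  have hp := p_sq h1
  rw [NZ_W_Ps, NZ_Z_Ps]
  unfold W1 Z1
  linear_combination (3 / 2 : ℝ) * hp + (3 / 2 : ℝ) * hq

/-- (2.3) for `Ž₁`. [cite: BuckmasterCaolaboraGomezserrano2025, eq. (2.3)] -/
theorem slope_eq_Z1check {r : ℝ} (h1 : 1 ≤ r) (h : 0 ≤ disc r) :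
    (1 / 3 * W1 r + 2 / 3 * Z1check r) * Z1check r =
      NZ_W (W0 r) (Z0 r) * W1 r + NZ_Z r (W0 r) (Z0 r) * Z1check r := by
  have hq := q_sq h
  have hp := p_sq h1
  rw [NZ_W_Ps, NZ_Z_Ps]
  unfold W1 Z1check
  linear_combination (3 / 2 : ℝ) * hp + (3 / 2 : ℝ) * hq

/-- The quadratic (2.3) has exactly the two roots `Z₁`, `Ž₁`. [cite: BuckmasterCaolaboraGomezserrano2025, §2.1] -/
theorem slope_eq_iff {r z : ℝ} (h1 : 1 ≤ r) (h : 0 ≤ disc r) :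
    (1 / 3 * W1 r + 2 / 3 * z) * z = NZ_W (W0 r) (Z0 r) * W1 r + NZ_Z r (W0 r) (Z0 r) * z ↔
      z = Z1 r ∨ z = Z1check r := by
  have hq := q_sq h
  have hp := p_sq h1
  rw [NZ_W_Ps, NZ_Z_Ps]
  constructor
  · intro hz
    have h2 : (2 / 3 * z - (2 - r + q r)) ^ 2 = p r ^ 2 := by
      unfold W1 at hz
      linear_combination (2 / 3 : ℝ) * hz - hp - hq
    rcases sq_eq_sq_iff_eq_or_eq_neg.mp h2 with h3 | h3
    · right; unfold Z1check; linarith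
    · left; unfold Z1; linarith
  · rintro (rfl | rfl)
    · simpa [NZ_W_Ps, NZ_Z_Ps] using slope_eq_Z1 h1 h
    · simpa [NZ_W_Ps, NZ_Z_Ps] using slope_eq_Z1check h1 h

/-- `D_{Z,1} = ∇D_Z(P_s)·(W₁,Z₁) = 2 − r − p`. [cite: BuckmasterCaolaboraGomezserrano2025, Lemma 2.1] -/
theorem DZ1_eq (r : ℝ) : 1 / 3 * W1 r + 2 / 3 * Z1 r = 2 - r - p r := by unfold W1 Z1; ring

/-- `Ď_{Z,1} = ∇D_Z(P_s)·(W₁,Ž₁) = 2 − r + p`. [cite: BuckmasterCaolaboraGomezserrano2025, Lemma 2.1] -/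
theorem DZ1check_eq (r : ℝ) : 1 / 3 * W1 r + 2 / 3 * Z1check r = 2 - r + p r := by
  unfold W1 Z1check; ring

/-- Lemma "aux_DZ1" at `γ = 5/3`: `D_{Z,1} > 0` for `1 ≤ r < r*`. [cite: BuckmasterCaolaboraGomezserrano2025, Lemma 2.1] -/
theorem DZ1_pos {r : ℝ} (h : r < rstar) : 0 < 2 - r - p r := by
  have h2 : 0 < 2 - r := by linarith [rstar_lt]
  have : p r < 2 - r := by
    unfold p
    rw [Real.sqrt_lt' h2]
    have := disc_pos h
    unfold disc at this
    nlinarith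
  linarith

/-- Lemma "aux_DZ1check" at `γ = 5/3`: `Ď_{Z,1} > 0` for `r < 2`. [cite: BuckmasterCaolaboraGomezserrano2025, Lemma 2.1] -/
theorem DZ1check_pos {r : ℝ} (h : r < 2) : 0 < 2 - r + p r := by linarith [p_nonneg r]

/-- Lemma "aux_DZ1_cancellation" at `γ = 5/3`: `D_{Z,1} = 0` at `r = r*`. [cite: BuckmasterCaolaboraGomezserrano2025, Lemma 2.1] -/
theorem DZ1_rstar : 2 - rstar - p rstar = 0 := by
  rw [p_rstar]; unfold rstar; ring

/-! ### `k(r)` and Lemma 2.1 -/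

/-- `k(r) = Ď_{Z,1}/D_{Z,1} = (2 − r + p)/(2 − r − p)` ((2.9) at `γ = 5/3`).
[cite: BuckmasterCaolaboraGomezserrano2025, eq. (2.9)] -/
def k (r : ℝ) : ℝ := (2 - r + p r) / (2 - r - p r)

/-- (2.9): `k = Ď_{Z,1}/D_{Z,1}`. [cite: BuckmasterCaolaboraGomezserrano2025, eq. (2.9)] -/
theorem k_eq_ratio (r : ℝ) :
    k r = (1 / 3 * W1 r + 2 / 3 * Z1check r) / (1 / 3 * W1 r + 2 / 3 * Z1 r) := by
  rw [DZ1_eq, DZ1check_eq]; rfl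

/-- Appendix form: `k = (A − Bℛ₂)/(A + Bℛ₂)`, `A = −5 + 3/γ + r(1 + 1/γ)`, `B = 1 − 1/γ`, at
`γ = 5/3` (`ℛ₂ = 4p`). [cite: BuckmasterCaolaboraGomezserrano2025, App. §10, proof of Lemma 2.1] -/
theorem k_eq_appendix {r : ℝ} (h : 2 - r - p r ≠ 0) :
    k r = ((-5 + 3 / (5 / 3 : ℝ) + r * (1 + 1 / (5 / 3 : ℝ))) - (1 - 1 / (5 / 3 : ℝ)) * (4 * p r)) /
      ((-5 + 3 / (5 / 3 : ℝ) + r * (1 + 1 / (5 / 3 : ℝ))) + (1 - 1 / (5 / 3 : ℝ)) * (4 * p r)) := by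
  have h' : (-5 + 3 / (5 / 3 : ℝ) + r * (1 + 1 / (5 / 3 : ℝ))) + (1 - 1 / (5 / 3 : ℝ)) * (4 * p r) ≠ 0 := by
    have : (-5 + 3 / (5 / 3 : ℝ) + r * (1 + 1 / (5 / 3 : ℝ))) + (1 - 1 / (5 / 3 : ℝ)) * (4 * p r)
        = -(8 / 5) * (2 - r - p r) := by ring
    rw [this]; exact mul_ne_zero (by norm_num) h
  unfold k
  rw [div_eq_div_iff h h']
  ring

/-- `k(1) = 1`. [cite: BuckmasterCaolaboraGomezserrano2025, Lemma 2.1] -/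
theorem k_one : k 1 = 1 := by unfold k; rw [p_one]; norm_num

/-- `k = 1 + 2p/D_{Z,1}`. [folklore] -/
theorem k_eq_one_add {r : ℝ} (h : 2 - r - p r ≠ 0) : k r = 1 + 2 * p r / (2 - r - p r) := by
  unfold k
  field_simp
  ring

/-- **Lemma 2.1 at γ = 5/3, monotonicity**: `k` is strictly increasing on `[1, r*)` (the paper
proves `k′ > 0` by a computer-assisted sign check; at `γ = 5/3` it is elementary).
[cite: BuckmasterCaolaboraGomezserrano2025, Lemma 2.1] -/
theorem k_strictMonoOn : StrictMonoOn k (Ico 1 rstar) := by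
  intro a ha b hb hab
  have hda := DZ1_pos ha.2
  have hdb := DZ1_pos hb.2
  rw [k_eq_one_add hda.ne', k_eq_one_add hdb.ne', add_lt_add_iff_left, mul_div_assoc,
    mul_div_assoc]
  refine mul_lt_mul_of_pos_left ?_ two_pos
  rw [div_lt_div_iff₀ hda hdb]
  have hpa : 0 ≤ p a := p_nonneg a
  have hpab : p a < p b := by
    unfold p
    exact Real.sqrt_lt_sqrt (by linarith [ha.1]) (by linarith)
  have hdd : 2 - b - p b < 2 - a - p a := by linarith
  nlinarith [mul_le_mul_of_nonneg_left hdd.le hpa, mul_lt_mul_of_pos_right hpab hda]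

/-- `k` is injective on `[1, r*)`: `r_j` with `k(r_j) = j` is unique. [cite: BuckmasterCaolaboraGomezserrano2025, Lemma 2.1] -/
theorem k_injOn : InjOn k (Ico 1 rstar) := k_strictMonoOn.injOn

/-- **Lemma 2.1 at γ = 5/3, blow-up**: `k(r) → +∞` as `r → r*⁻`.
[cite: BuckmasterCaolaboraGomezserrano2025, Lemma 2.1] -/
theorem tendsto_k_rstar : Tendsto k (𝓝[<] rstar) atTop := by
  have hcont_p : Continuous p := by
    unfold p; fun_prop
  -- numerator → 2(√3 − 1) > 0
  have hnum : Tendsto (fun r => 2 * p r) (𝓝[<] rstar) (𝓝 (2 * (√3 - 1))) := by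
    rw [← p_rstar]
    exact ((hcont_p.tendsto rstar).const_mul 2).mono_left nhdsWithin_le_nhds
  have hnum_pos : 0 < 2 * (√3 - 1) := by
    have : (1 : ℝ) < √3 := (Real.lt_sqrt (by norm_num)).mpr (by norm_num)
    linarith
  -- denominator → 0⁺
  have hden0 : Tendsto (fun r => 2 - r - p r) (𝓝[<] rstar) (𝓝 0) := by
    rw [← DZ1_rstar]
    have hc : Continuous fun r => 2 - r - p r := by fun_prop
    exact (hc.tendsto rstar).mono_left nhdsWithin_le_nhds
  have hden_pos : ∀ᶠ r in 𝓝[<] rstar, 2 - r - p r ∈ Ioi (0 : ℝ) := by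
    have hmem : Ioo 1 rstar ∈ 𝓝[<] rstar := Ioo_mem_nhdsLT one_lt_rstar
    filter_upwards [hmem] with r hr
    exact DZ1_pos hr.2
  have hden : Tendsto (fun r => 2 - r - p r) (𝓝[<] rstar) (𝓝[>] 0) :=
    tendsto_nhdsWithin_iff.mpr ⟨hden0, hden_pos⟩
  have hinv : Tendsto (fun r => (2 - r - p r)⁻¹) (𝓝[<] rstar) atTop := hden.inv_tendsto_nhdsGT_zero
  have hprod : Tendsto (fun r => 2 * p r * (2 - r - p r)⁻¹) (𝓝[<] rstar) atTop :=
    hnum.pos_mul_atTop hnum_pos hinv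
  have hk : ∀ᶠ r in 𝓝[<] rstar, 1 + 2 * p r * (2 - r - p r)⁻¹ = k r := by
    filter_upwards [hden_pos] with r hr
    rw [k_eq_one_add (ne_of_gt hr), div_eq_mul_inv, mul_assoc]
  exact (tendsto_atTop_add_const_left _ 1 hprod).congr' hk

/-! ### `r₃(5/3)`, `r₄(5/3)` in closed form, and the window of the vendored fact -/

/-- `r₃(5/3) = 6 − 2√6` (the root of `k(r) = 3`, i.e. of `r² − 12r + 12 = 0`, in `(1, r*)`).
[cite: BuckmasterCaolaboraGomezserrano2025, §1.4 (`k(r_j) = j`), App. Lemma 10.1] -/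
def r3 : ℝ := 6 - 2 * √6

/-- `r₄(5/3) = (43 − 5√43)/9` (the root of `k(r) = 4`, i.e. of `9r² − 86r + 86 = 0`, in `(1, r*)`).
[cite: BuckmasterCaolaboraGomezserrano2025, §1.4 (`k(r_j) = j`), App. Lemma 10.2] -/
def r4 : ℝ := (43 - 5 * √43) / 9

/-- [folklore] -/
private theorem sqrt6_sq : (√6 : ℝ) ^ 2 = 6 := Real.sq_sqrt (by norm_num)
/-- [folklore] -/
private theorem sqrt43_sq : (√43 : ℝ) ^ 2 = 43 := Real.sq_sqrt (by norm_num)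
/-- [folklore] -/
private theorem sqrt6_lt : √6 < (2.44949 : ℝ) := (Real.sqrt_lt' (by norm_num)).mpr (by norm_num)
/-- [folklore] -/
private theorem lt_sqrt6 : (2.449485 : ℝ) < √6 := (Real.lt_sqrt (by norm_num)).mpr (by norm_num)
/-- [folklore] -/
private theorem sqrt43_lt : √43 < (6.55745 : ℝ) := (Real.sqrt_lt' (by norm_num)).mpr (by norm_num)
/-- [folklore] -/
private theorem lt_sqrt43 : (6.557432 : ℝ) < √43 := (Real.lt_sqrt (by norm_num)).mpr (by norm_num)

/-- Enclosure of `r₃(5/3)` (cf. Lemma 10.1 at `γ_inv = 3/5`: `1.1010205 ± 1.5·10⁻⁸`).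
[cite: BuckmasterCaolaboraGomezserrano2025, App. Lemma 10.1] -/
theorem r3_bounds : (1.10102 : ℝ) < r3 ∧ r3 < (1.10103 : ℝ) := by
  unfold r3
  constructor <;> linarith [sqrt6_lt, lt_sqrt6]

/-- Enclosure of `r₄(5/3)` (cf. Lemma 10.2 at `γ_inv = 3/5`: `1.1347564 ± 1.5·10⁻⁸`).
[cite: BuckmasterCaolaboraGomezserrano2025, App. Lemma 10.2] -/
theorem r4_bounds : (1.13475 : ℝ) < r4 ∧ r4 < (1.13476 : ℝ) := by
  unfold r4
  constructor <;> linarith [sqrt43_lt, lt_sqrt43]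

/-- `1 < r₃ < r₄ < r*`. [cite: BuckmasterCaolaboraGomezserrano2025, §1.4] -/
theorem r3_r4_mem : 1 < r3 ∧ r3 < r4 ∧ r4 < rstar := by
  have h3 := r3_bounds
  have h4 := r4_bounds
  have h5 : (1.26 : ℝ) < rstar := by
    unfold rstar
    have : √3 < (1.74 : ℝ) := (Real.sqrt_lt' (by norm_num)).mpr (by norm_num)
    linarith
  refine ⟨by linarith, by linarith, by linarith⟩

/-- The window of the vendored fact `BuckmasterCaolaboraGomezserrano2025_thm11_monatomic` contains
`(r₃(5/3), r₄(5/3))`: `1.10102 < r₃` and `r₄ < 1.13476`. [cite: BuckmasterCaolaboraGomezserrano2025, Thm 1.1, App. Lemmas 10.1–10.2] -/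
theorem window : (1.10102 : ℝ) < r3 ∧ r4 < (1.13476 : ℝ) := ⟨r3_bounds.1, r4_bounds.2⟩

/-- `p(r₃) = √6 − 2`. [folklore] -/
theorem p_r3 : p r3 = √6 - 2 := by
  unfold p r3
  have h0 : (0 : ℝ) ≤ √6 - 2 := by linarith [lt_sqrt6]
  rw [show (2 : ℝ) * (6 - 2 * √6 - 1) = (√6 - 2) ^ 2 by linear_combination (-1 : ℝ) * sqrt6_sq]
  exact Real.sqrt_sq h0

/-- `p(r₄) = (√43 − 5)/3`. [folklore] -/
theorem p_r4 : p r4 = (√43 - 5) / 3 := by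
  unfold p r4
  have h0 : (0 : ℝ) ≤ (√43 - 5) / 3 := by linarith [lt_sqrt43]
  rw [show (2 : ℝ) * ((43 - 5 * √43) / 9 - 1) = ((√43 - 5) / 3) ^ 2 by
    linear_combination (-1 / 9 : ℝ) * sqrt43_sq]
  exact Real.sqrt_sq h0

/-- **`k(r₃) = 3`**: `r₃ = 6 − 2√6` is the paper's `r₃(5/3)`. [cite: BuckmasterCaolaboraGomezserrano2025, §1.4, Lemma 2.1] -/
theorem k_r3 : k r3 = 3 := by
  unfold k
  rw [p_r3]
  unfold r3
  have hne : (2 : ℝ) - (6 - 2 * √6) - (√6 - 2) ≠ 0 := by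
    have : (2 : ℝ) - (6 - 2 * √6) - (√6 - 2) = √6 - 2 := by ring
    rw [this]; linarith [lt_sqrt6]
  rw [div_eq_iff hne]
  ring

/-- **`k(r₄) = 4`**: `r₄ = (43 − 5√43)/9` is the paper's `r₄(5/3)`. [cite: BuckmasterCaolaboraGomezserrano2025, §1.4, Lemma 2.1] -/
theorem k_r4 : k r4 = 4 := by
  unfold k
  rw [p_r4]
  unfold r4
  have hne : (2 : ℝ) - (43 - 5 * √43) / 9 - (√43 - 5) / 3 ≠ 0 := by
    have : (2 : ℝ) - (43 - 5 * √43) / 9 - (√43 - 5) / 3 = 2 * (√43 - 5) / 9 := by ring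
    rw [this]; linarith [lt_sqrt43]
  rw [div_eq_iff hne]
  ring

/-- `r₃`, `r₄` are the unique solutions of `k = 3`, `k = 4` in `[1, r*)`. [cite: BuckmasterCaolaboraGomezserrano2025, §1.4, Lemma 2.1] -/
theorem k_eq_three_iff {r : ℝ} (hr : r ∈ Ico 1 rstar) : k r = 3 ↔ r = r3 := by
  have h3 : r3 ∈ Ico 1 rstar := ⟨r3_r4_mem.1.le, r3_r4_mem.2.1.trans r3_r4_mem.2.2⟩
  constructor
  · intro h
    exact k_injOn hr h3 (h.trans k_r3.symm)
  · rintro rfl; exact k_r3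

/-- [cite: BuckmasterCaolaboraGomezserrano2025, §1.4, Lemma 2.1] -/
theorem k_eq_four_iff {r : ℝ} (hr : r ∈ Ico 1 rstar) : k r = 4 ↔ r = r4 := by
  have h4 : r4 ∈ Ico 1 rstar := ⟨(r3_r4_mem.1.trans r3_r4_mem.2.1).le, r3_r4_mem.2.2⟩
  constructor
  · intro h
    exact k_injOn hr h4 (h.trans k_r4.symm)
  · rintro rfl; exact k_r4

/-- For `r ∈ (r₃, r₄)`: `3 < k(r) < 4` (so `m − k ≠ 0` for every integer `m`, Prop. 2.2).
[cite: BuckmasterCaolaboraGomezserrano2025, Prop. 2.2] -/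
theorem k_mem_Ioo {r : ℝ} (h3 : r3 < r) (h4 : r < r4) : 3 < k r ∧ k r < 4 := by
  have hm := r3_r4_mem
  have hr3 : r3 ∈ Ico 1 rstar := ⟨hm.1.le, hm.2.1.trans hm.2.2⟩
  have hr4 : r4 ∈ Ico 1 rstar := ⟨(hm.1.trans hm.2.1).le, hm.2.2⟩
  have hr : r ∈ Ico 1 rstar := ⟨(hm.1.trans h3).le, h4.trans hm.2.2⟩
  exact ⟨k_r3 ▸ k_strictMonoOn hr3 hr h3, k_r4 ▸ k_strictMonoOn hr hr4 h4⟩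

end Monatomic

end BuckmasterCaolaboraGomezserrano2025

end Literature.Analysis.FluidPDE
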